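import Literature.NumberTheory.GaloisRepresentations.CohomologicalDimensionCriterion
import Literature.NumberTheory.GaloisRepresentations.FiniteCoefficients
import Mathlib.GroupTheory.PGroup
import Mathlib.GroupTheory.Perm.Cycle.Type
import Mathlib.GroupTheory.SpecificGroups.Cyclic
import Mathlib.Data.Nat.Factors
import HarnessLib

/-!
# Dévissage of finite `p`-primary modules over a `p`-extension (Serre I §3.3 / II §3.1)

Let `G` be a compact group, `p` a prime and `N₀ ⊴ G` a normal subgroup such that `G/N₀` is a
finite `p`-group.  If `H²(G, W) = 0` for every finite discrete `G`-module `W` of order `p` with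
**trivial** action, then `H²(G, B) = 0` for every finite discrete `p`-primary `G`-module `B` on
which `N₀` acts trivially (`subsingleton_two_of_pGroup_quotient`): `G` acts on `B` through the
`p`-group `G/N₀`, which has a non-zero fixed vector (`exists_ne_zero_forall_apply_eq`, Mathlib
`IsPGroup.card_modEq_card_fixedPoints`), hence `B` contains a line `ℤ b₁ ≅ ℤ/p` with trivial
action (`exists_line`), and one concludes by induction on `|B|` through
`0 → ℤ b₁ → B → B/ℤ b₁ → 0` (`IsSES.subsingleton_X₂`).  This is the reduction "aux `G_k`-modules
simples … isomorphe à `ℤ/pℤ`" in the proofs of Serre II §2.2 Prop. 3 and II §3.1 Prop. 5 (via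
I §3.3 Cor. 1, `cd_p(G) = cd_p(G_p)`), in the form used for
`Literature.NumberTheory.GaloisRepresentations.tsen_fieldCdLE_one_of_trdeg_eq_one`.

Also: short exactness of `0 → W → B → B/W → 0` for a stable submodule (`isSES_subtype_mkQ`),
vanishing of the cohomology of the zero module, `|B| = p^m` for finite `p`-primary `B`, and the
transport of vanishing between isomorphic trivial modules of order `p`
(`subsingleton_of_trivial_of_card_eq`).

## References

* J.-P. Serre, *Cohomologie galoisienne* (1997), I §3.3 Cor. 1, II §2.2 Prop. 3, II §3.1 Prop. 5.
  [SerreGaloisCohomology1997]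
-/

noncomputable section

open CategoryTheory Topology MulAction

universe u

namespace Literature.NumberTheory.GaloisRepresentations

open _root_.TopRep _root_.ContRepresentation _root_.ContinuousCohomology

set_option allowUnsafeReducibility true in
attribute [local reducible] CategoryTheory.Functor.mapHomologicalComplex

section Generic

variable {G : Type u} [Group G] [TopologicalSpace G] [IsTopologicalGroup G]
variable {M : Type u} [AddCommGroup M] [TopologicalSpace M] [DiscreteTopology M]

/-- **`0 → W → M → M/W → 0` is short exact** for a `G`-stable submodule `W` of a discrete module
(the tree's `subtypeHom`, `mkQHom`). [folklore] -/
theorem isSES_subtype_mkQ (ρ : ContinuousRep G ℤ M) (W : Submodule ℤ M)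
    (hW : ∀ g, W ≤ W.comap (ρ g)) : IsSES (subtypeHom ρ W hW) (ρ.mkQHom W hW) where
  comp_eq_zero := by
    ext w
    change Submodule.Quotient.mk (p := W) (w : M) = 0
    exact (Submodule.Quotient.mk_eq_zero W).2 w.2
  injective := Subtype.val_injective
  exact_mid := fun y hy => ⟨⟨y, (Submodule.Quotient.mk_eq_zero W).1 hy⟩, rfl⟩
  surjective := Submodule.Quotient.mk_surjective W

omit [DiscreteTopology M] in
/-- The terms of the standard resolution of the zero module are zero. [folklore] -/
theorem subsingleton_resolutionX {k : Type*} [Ring k] [TopologicalSpace k] (X : TopRep k G)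
    [Subsingleton X] : ∀ n : ℕ, Subsingleton (resolutionX X n)
  | 0 => inferInstanceAs (Subsingleton X)
  | n + 1 =>
    haveI := subsingleton_resolutionX X n
    ⟨fun _ _ => ContinuousMap.ext fun _ => Subsingleton.elim _ _⟩

omit [DiscreteTopology M] in
/-- **The cohomology of the zero module vanishes.** [folklore] -/
theorem subsingleton_continuousCohomology_of_subsingleton {k : Type*} [Ring k] [TopologicalSpace k]
    (X : TopRep k G) [Subsingleton X] (n : ℕ) : Subsingleton (continuousCohomology (n + 1) X) := by
  haveI := subsingleton_resolutionX X (n + 2)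
  refine (subsingleton_homology_succ_iff _ n).2 fun x _ => ⟨0, ?_⟩
  apply Subtype.ext
  exact Subsingleton.elim _ _

/-- **A finite `p`-primary abelian group has order a power of `p`** (Cauchy). [folklore] -/
theorem exists_card_eq_prime_pow {p : ℕ} [hp : Fact p.Prime] (B : Type*) [AddCommGroup B]
    [Finite B] (hB : IsPrimaryTorsion p B) : ∃ m : ℕ, Nat.card B = p ^ m := by
  classical
  letI := Fintype.ofFinite B
  refine ⟨_, Nat.eq_prime_pow_of_unique_prime_dvd Nat.card_pos.ne' ?_⟩
  intro q hq hqd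
  haveI : Fact q.Prime := ⟨hq⟩
  rw [Nat.card_eq_fintype_card] at hqd
  obtain ⟨b, hb⟩ := exists_prime_addOrderOf_dvd_card q hqd
  obtain ⟨r, hr⟩ := hB b
  have h1 : addOrderOf b ∣ p ^ r := addOrderOf_dvd_of_nsmul_eq_zero hr
  rw [hb] at h1
  exact (Nat.prime_dvd_prime_iff_eq hq hp.out).1 (hq.dvd_of_dvd_pow h1)

/-- **A `p`-group acting on a finite `p`-primary module `B ≠ 0` fixes a non-zero vector**: here
`G` acting through the finite `p`-group `G/N₀` (`N₀` acting trivially); Mathlib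
`IsPGroup.card_modEq_card_fixedPoints` applied to the action of `G/N₀` on `B^{N₀} = B`.
[cite: SerreGaloisCohomology1997, I §3.3] -/
theorem exists_ne_zero_forall_apply_eq {p : ℕ} [hp : Fact p.Prime] (N₀ : Subgroup G) [N₀.Normal]
    [Finite (G ⧸ N₀)] (hQ : IsPGroup p (G ⧸ N₀)) [Finite M] [Nontrivial M]
    (τ : ContinuousRep G ℤ M) (hB : IsPrimaryTorsion p M) (hN₀ : ∀ g ∈ N₀, ∀ b : M, τ g b = b) :
    ∃ b : M, b ≠ 0 ∧ ∀ g : G, τ g b = b := by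
  classical
  let W := τ.invariantsOf N₀
  let ρQ := τ.quotientInvariants N₀
  -- every vector is `N₀`-invariant
  have hmem : ∀ b : M, b ∈ W := fun b => (ContinuousRep.mem_invariantsOf_iff _ _ _).2 fun n =>
    hN₀ n n.2 b
  let eW : M ≃ W := ⟨fun b => ⟨b, hmem b⟩, fun w => w, fun _ => rfl, fun _ => rfl⟩
  haveI : Finite W := Finite.of_equiv M eW
  -- the action of the `p`-group `G/N₀` on `W`
  letI : MulAction (G ⧸ N₀) W :=
    { smul := fun q w => ρQ q w
      one_smul := fun w => by
        change ρQ 1 w = w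
        rw [map_one]
        rfl
      mul_smul := fun q q' w => by
        change ρQ (q * q') w = ρQ q (ρQ q' w)
        rw [map_mul]
        rfl }
  -- cardinalities
  obtain ⟨m, hm⟩ := exists_card_eq_prime_pow M hB
  have hcardW : Nat.card W = p ^ m := by rw [← hm]; exact (Nat.card_congr eW).symm
  have hm0 : m ≠ 0 := by
    rintro rfl
    rw [pow_zero] at hm
    exact (Finite.one_lt_card_iff_nontrivial.2 ‹Nontrivial M›).ne' hm
  have hmod := hQ.card_modEq_card_fixedPoints W
  rw [hcardW, Nat.ModEq, Nat.pow_mod, Nat.mod_self, zero_pow hm0, Nat.zero_mod] at hmod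
  -- `fixedPoints` contains `0` and has cardinality divisible by `p`, hence another element
  have h0 : (0 : W) ∈ fixedPoints (G ⧸ N₀) W := fun q => by
    change ρQ q 0 = 0
    exact map_zero _
  haveI : Finite (fixedPoints (G ⧸ N₀) W) := Subtype.finite
  letI := Fintype.ofFinite (fixedPoints (G ⧸ N₀) W)
  have hlt : 1 < Fintype.card (fixedPoints (G ⧸ N₀) W) := by
    rw [← Nat.card_eq_fintype_card]
    have hpos : 0 < Nat.card (fixedPoints (G ⧸ N₀) W) :=
      Nat.card_pos_iff.2 ⟨⟨⟨0, h0⟩⟩, inferInstance⟩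
    have hdvd : p ∣ Nat.card (fixedPoints (G ⧸ N₀) W) := Nat.dvd_of_mod_eq_zero hmod.symm
    exact lt_of_lt_of_le hp.out.one_lt (Nat.le_of_dvd hpos hdvd)
  obtain ⟨⟨w, hw⟩, hw0⟩ := Fintype.exists_ne_of_one_lt_card hlt ⟨0, h0⟩
  refine ⟨(w : M), fun h => hw0 (Subtype.ext (Subtype.ext h)), fun g => ?_⟩
  have h1 : ρQ (g : G ⧸ N₀) w = w := hw (g : G ⧸ N₀)
  exact congrArg (fun v : W => (v : M)) h1

omit [IsTopologicalGroup G] [DiscreteTopology M] in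
/-- **A fixed vector of a `p`-primary module yields a fixed vector of order `p`.** [folklore] -/
theorem exists_line {p : ℕ} (τ : ContinuousRep G ℤ M) (hB : IsPrimaryTorsion p M)
    (b : M) (hb0 : b ≠ 0) (hb : ∀ g : G, τ g b = b) :
    ∃ b₁ : M, b₁ ≠ 0 ∧ p • b₁ = 0 ∧ ∀ g : G, τ g b₁ = b₁ := by
  classical
  have hex : ∃ n : ℕ, p ^ n • b = 0 := hB b
  let n₀ := Nat.find hex
  have hn₀ : p ^ n₀ • b = 0 := Nat.find_spec hex
  have hn₀0 : n₀ ≠ 0 := by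
    intro h
    rw [h, pow_zero, one_smul] at hn₀
    exact hb0 hn₀
  obtain ⟨n₁, hn₁⟩ := Nat.exists_eq_succ_of_ne_zero hn₀0
  refine ⟨p ^ n₁ • b, ?_, ?_, fun g => by rw [map_nsmul, hb]⟩
  · have h := Nat.find_min hex (show n₁ < n₀ by omega)
    exact h
  · rw [← mul_smul, ← pow_succ', ← Nat.succ_eq_add_one, ← hn₁]
    exact hn₀

omit [IsTopologicalGroup G] [DiscreteTopology M] in
/-- The line through a fixed vector is `G`-stable. [folklore] -/
theorem span_singleton_le_comap (τ : ContinuousRep G ℤ M) (b₁ : M) (hb : ∀ g : G, τ g b₁ = b₁)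
    (g : G) : Submodule.span ℤ {b₁} ≤ (Submodule.span ℤ {b₁}).comap (τ g) := by
  intro x hx
  obtain ⟨a, rfl⟩ := Submodule.mem_span_singleton.1 hx
  rw [Submodule.mem_comap, map_zsmul, hb]
  exact hx

omit [IsTopologicalGroup G] [DiscreteTopology M] in
/-- `G` acts trivially on the line through a fixed vector. [folklore] -/
theorem subrepresentation_span_apply (τ : ContinuousRep G ℤ M) (b₁ : M) (hb : ∀ g : G, τ g b₁ = b₁)
    (g : G) (w : Submodule.span ℤ {b₁}) :
    τ.subrepresentation (Submodule.span ℤ {b₁}) (span_singleton_le_comap τ b₁ hb) g w = w := by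
  apply Subtype.ext
  rw [ContinuousRep.subrepresentation_apply_coe]
  obtain ⟨a, ha⟩ := Submodule.mem_span_singleton.1 w.2
  rw [← ha, map_zsmul, hb]

omit [TopologicalSpace M] [DiscreteTopology M] in
/-- The line through a vector of order `p` has `p` elements. [folklore] -/
theorem natCard_span_singleton {p : ℕ} [hp : Fact p.Prime] (b₁ : M) (hb0 : b₁ ≠ 0)
    (hpb : p • b₁ = 0) : Nat.card (Submodule.span ℤ {b₁}) = p := by
  have h1 : Nat.card (Submodule.span ℤ {b₁}) = Nat.card (AddSubgroup.zmultiples b₁) :=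
    Nat.card_congr (Equiv.subtypeEquivRight fun x => by
      rw [Submodule.mem_span_singleton, AddSubgroup.mem_zmultiples_iff])
  rw [h1, Nat.card_zmultiples, addOrderOf_eq_prime hpb hb0]

/-- **Isomorphic trivial modules of prime order**: two finite discrete `G`-modules of the same
prime order with trivial action have the same cohomology vanishing (they are isomorphic,
`zmodAddCyclicAddEquiv`; `subsingleton_continuousCohomology_of_iso`). [folklore] -/
theorem subsingleton_of_trivial_of_card_eq {A₁ : Type u} [AddCommGroup A₁] [TopologicalSpace A₁]
    [DiscreteTopology A₁] [Finite A₁] {A₂ : Type u} [AddCommGroup A₂] [TopologicalSpace A₂]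
    [DiscreteTopology A₂] [Finite A₂] (σ₁ : ContinuousRep G ℤ A₁) (σ₂ : ContinuousRep G ℤ A₂)
    (h₁ : ∀ (g : G) (a : A₁), σ₁ g a = a) (h₂ : ∀ (g : G) (a : A₂), σ₂ g a = a)
    {p : ℕ} [hp : Fact p.Prime] (hc₁ : Nat.card A₁ = p) (hc₂ : Nat.card A₂ = p) (q : ℕ)
    (hs : Subsingleton (continuousCohomology q σ₁.toTopRep)) :
    Subsingleton (continuousCohomology q σ₂.toTopRep) := by
  have hcyc₁ : IsAddCyclic A₁ := isAddCyclic_of_prime_card hc₁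
  have hcyc₂ : IsAddCyclic A₂ := isAddCyclic_of_prime_card hc₂
  let e : A₁ ≃+ A₂ := (zmodAddCyclicAddEquiv hcyc₁).symm.trans
    ((ZMod.ringEquivCongr (hc₁.trans hc₂.symm)).toAddEquiv.trans (zmodAddCyclicAddEquiv hcyc₂))
  let E : A₁ ≃L[ℤ] A₂ :=
    { e.toIntLinearEquiv with
      continuous_toFun := continuous_of_discreteTopology
      continuous_invFun := continuous_of_discreteTopology }
  have he : ∀ (g : G) (x : A₁), E (σ₁.toTopRep.ρ g x) = σ₂.toTopRep.ρ g (E x) := fun g x => by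
    change E (σ₁ g x) = σ₂ g (E x)
    rw [h₁, h₂]
  haveI := hs
  exact subsingleton_continuousCohomology_of_iso
    (topRepIsoOfEquiv (X := σ₁.toTopRep) (Y := σ₂.toTopRep) E he) q

end Generic

/-! ### The dévissage -/

section Devissage

variable {G : Type u} [Group G] [TopologicalSpace G] [IsTopologicalGroup G] [CompactSpace G]

/-- **Dévissage over a `p`-extension**: if `G/N₀` is a finite `p`-group and `H²(G, W) = 0` for all
finite `W` of order `p` with trivial action, then `H²(G, B) = 0` for every finite discrete
`p`-primary `B` on which `N₀` acts trivially (induction on `|B|` through a fixed line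
`ℤ/p ⊆ B`). [cite: SerreGaloisCohomology1997, I §3.3 Cor. 1 and II §3.1 Prop. 5] -/
theorem subsingleton_two_of_pGroup_quotient {p : ℕ} [hp : Fact p.Prime] (N₀ : Subgroup G)
    [N₀.Normal] [Finite (G ⧸ N₀)] (hQ : IsPGroup p (G ⧸ N₀))
    (hP : ∀ (W : Type u) [AddCommGroup W] [TopologicalSpace W] [DiscreteTopology W] [Finite W]
      (σ : ContinuousRep G ℤ W), (∀ (g : G) (w : W), σ g w = w) → Nat.card W = p →
        Subsingleton (continuousCohomology 2 σ.toTopRep))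
    (B : Type u) [AddCommGroup B] [TopologicalSpace B] [DiscreteTopology B] [Finite B]
    (τ : ContinuousRep G ℤ B) (hB : IsPrimaryTorsion p B) (hN₀ : ∀ g ∈ N₀, ∀ b : B, τ g b = b) :
    Subsingleton (continuousCohomology 2 τ.toTopRep) := by
  classical
  suffices key : ∀ (n : ℕ) (B : Type u) [AddCommGroup B] [TopologicalSpace B] [DiscreteTopology B]
      [Finite B] (τ : ContinuousRep G ℤ B), IsPrimaryTorsion p B →
      (∀ g ∈ N₀, ∀ b : B, τ g b = b) → Nat.card B = n →
      Subsingleton (continuousCohomology 2 τ.toTopRep) from key _ B τ hB hN₀ rfl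
  intro n
  induction n using Nat.strong_induction_on with
  | _ n ih =>
    intro B _ _ _ _ τ hB hN₀ hn
    by_cases hsub : Subsingleton B
    · exact subsingleton_continuousCohomology_of_subsingleton τ.toTopRep 1
    · haveI : Nontrivial B := not_subsingleton_iff_nontrivial.1 hsub
      obtain ⟨b, hb0, hbfix⟩ := exists_ne_zero_forall_apply_eq N₀ hQ τ hB hN₀
      obtain ⟨b₁, hb₁0, hpb₁, hb₁fix⟩ := exists_line τ hB b hb0 hbfix
      let W₁ : Submodule ℤ B := Submodule.span ℤ {b₁}
      have hW₁ : ∀ g, W₁ ≤ W₁.comap (τ g) := span_singleton_le_comap τ b₁ hb₁fix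
      have hSES := isSES_subtype_mkQ τ W₁ hW₁
      have hcardW : Nat.card W₁ = p := natCard_span_singleton b₁ hb₁0 hpb₁
      -- the line
      have h₁ : Subsingleton (continuousCohomology 2 (τ.subrepresentation W₁ hW₁).toTopRep) :=
        hP W₁ (τ.subrepresentation W₁ hW₁) (subrepresentation_span_apply τ b₁ hb₁fix) hcardW
      -- the quotient, by induction
      haveI : Finite (B ⧸ W₁) := Finite.of_surjective _ (Submodule.Quotient.mk_surjective W₁)
      have hlt : Nat.card (B ⧸ W₁) < n := by
        have hmul : Nat.card B = Nat.card (B ⧸ W₁) * Nat.card W₁ :=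
          AddSubgroup.card_eq_card_quotient_mul_card_addSubgroup W₁.toAddSubgroup
        rw [hn, hcardW] at hmul
        rw [hmul]
        exact (Nat.lt_mul_iff_one_lt_right Nat.card_pos).2 hp.out.one_lt
      have htriv : ∀ g ∈ N₀, ∀ x : B ⧸ W₁, τ.quotient W₁ hW₁ g x = x := fun g hg x => by
        induction x using Submodule.Quotient.induction_on with
        | _ m => rw [ContinuousRep.quotient_apply_mk, hN₀ g hg m]
      have h₃ : Subsingleton (continuousCohomology 2 (τ.quotient W₁ hW₁).toTopRep) :=
        ih _ hlt (B ⧸ W₁) (τ.quotient W₁ hW₁) (hB.quotient W₁) htriv rfl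
      exact hSES.subsingleton_X₂ 1 h₁ h₃

end Devissage

end Literature.NumberTheory.GaloisRepresentations

end
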